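import Summits.Langlands.Langlands.Theses.ParityBlindBianchi
import HarnessLib

/-!
# PromoteB — the `@[conjecture]` layer-2 item the planner is asked to file for the crux
# `TwoAdicBianchiProModularityLevel` (stmt-Langlands-15110), and its kernel-checked closing term

Crux workfile of line `Sketch` (lead c4, 2026-08-16; supersedes the evidence-only `PromoteB.lean` of lead c2).

`ArtinLiftIsHeckePointTwo` below is the registered stub `stub_artinLift` (B) of `Lines/Sketch.lean`, VERBATIM,
spelled in the fully-qualified vocabulary of `Theses/ParityBlindBianchi.lean` (no `open`s needed beyond that
file's own), so that a planner can paste its body as a new route decl (kind `crux`/`@[conjecture]`, layer 2 of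
the route's TWO-LAYER PLAN: "BigRT2Bianchi → ArtinLiftIsHeckePoint").  Mathematically it is big `R = 𝕋` for
`GL₂/K` in defect `l₀ = 1` at `p = 2`, read at the Artin point: residual occurrence of the Hansen data `a` of an
icosahedral finite-image `σ : Γ_K → GL₂(ℚ̄₂)` (2-split imaginary quadratic `K`) in the big Hecke algebra of
the `2`-power Bianchi tower at some tame level `U₀` hyperspecial off `S₀ ∋ 2` implies that `a` itself is a
continuous `𝒪_{ℚ̄₂}`-point of `Spf 𝕋(U²)` for some tame level `U` hyperspecial off `S₀`
([GeeNewton2020, Conj. 60, Prop. 62]; [CalegariGeraghty2017, Thm 1.1]; [HansenUniversalEigenvarieties2017,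
Conj. 1.2.3]).  OPEN PROBLEM — it is the open content of the crux; four consecutive line leads (c1–c4) and
the crux disprover found no formal escape and no misstatement.

`artinLiftIsHeckePointTwo_iff_stub` certifies (`Iff.rfl`) that it is the registered stub verbatim.  Closing term: with
`X_B := ArtinLiftIsHeckePointTwo` a route decl and A the Literature named fact `bianchi_regularAlgebraicCuspidal_isHeckePoint`
(Eichler–Shimura–Harder + Scholze §V.4; discharge active in the Literature debt queue), the crux E2′ is
`TwoAdicBianchiProModularityLevel_of_artinLift ‹A› X_B_holds` (bridge landed as p108612).
-/

noncomputable section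

set_option linter.dupNamespace false

namespace Summit.Langlands.Langlands.Cruxes.TwoAdicBianchiProModularityLevel.PromoteB

/-- **(B) `ArtinLiftIsHeckePointTwo` — residual occurrence implies occurrence of the icosahedral Artin lift in the
completed cohomology of the `2`-power Bianchi tower (big `R = 𝕋` for `GL₂/K`, `l₀ = 1`, `p = 2`, at the Artin
point).**  For `K` imaginary quadratic with `2` split, `σ : Γ_K → GL₂(ℚ̄₂)` continuous with finite image,
irreducible, projective image `A₅`, `S₀ ∋ 2`, uniformisers `ϖ`, and `𝒪_{ℚ̄₂}`-valued Hecke data `a`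
Hansen-associated with `σ` at every good place: IF some `𝒪_{ℚ̄₂}`-point `b` of `Spf 𝕋(U₀²)` (`IsHeckePoint`,
`U₀` open, `≤ GL₂(𝒪̂_K)`, containing every integral `g` trivial at the bad places) has `‖b − a‖ < 1` at every
good place, THEN `a` is a point of `Spf 𝕋(U²)` for some such tame level `U`.  Verbatim the registered stub
`stub_artinLift` of `Cruxes/TwoAdicBianchiProModularityLevel/Lines/Sketch.lean`, fully qualified.
[cite: GeeNewton2020, §5.1, Def. 59, Conj. 60, Rem. 61, Prop. 62] [cite: CalegariGeraghty2017, Thm. 1.1 and §1]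
[cite: HansenUniversalEigenvarieties2017, Conj. 1.2.3] [difficulty: open-problem] -/
def ArtinLiftIsHeckePointTwo : Prop :=
  ∀ (K : Type) [Field K] [NumberField K], NumberField.IsTotallyComplex K → Module.finrank ℚ K = 2 → (∃ v w : IsDedekindDomain.HeightOneSpectrum (NumberField.RingOfIntegers K), v ≠ w ∧ ((2 : ℕ) : NumberField.RingOfIntegers K) ∈ v.asIdeal ∧ ((2 : ℕ) : NumberField.RingOfIntegers K) ∈ w.asIdeal) → ∀ (σ : Literature.NumberTheory.GaloisRepresentations.FramedGaloisRep K (PadicAlgCl 2) 2), Finite σ.toMonoidHom.range → σ.toGaloisRep.IsIrreducible → Nonempty ((Matrix.ProjGenLinGroup.mk.comp σ.toMonoidHom).range ≃* alternatingGroup (Fin 5)) → ∀ S₀ : Finset ℕ, 2 ∈ S₀ → ∀ (ϖ : ∀ v : IsDedekindDomain.HeightOneSpectrum (NumberField.RingOfIntegers K), (v.adicCompletion K)ˣ), (∀ v : IsDedekindDomain.HeightOneSpectrum (NumberField.RingOfIntegers K), Valued.v ((ϖ v : (v.adicCompletion K)ˣ) : v.adicCompletion K) = WithZero.exp (-1 :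 ℤ)) → ∀ (a : {v : IsDedekindDomain.HeightOneSpectrum (NumberField.RingOfIntegers K) // ∀ ℓ ∈ S₀, ((ℓ : ℕ) : NumberField.RingOfIntegers K) ∉ v.asIdeal} → ℕ → (Valued.v (R := PadicAlgCl 2)).valuationSubring), (∀ (v : IsDedekindDomain.HeightOneSpectrum (NumberField.RingOfIntegers K)) (hv : ∀ ℓ ∈ S₀, ((ℓ : ℕ) : NumberField.RingOfIntegers K) ∉ v.asIdeal), σ.IsHeckeAssociatedAt v (fun i : ℕ => if i = 0 then (1 : PadicAlgCl 2) else ((a ⟨v, hv⟩ i : (Valued.v (R := PadicAlgCl 2)).valuationSubring) : PadicAlgCl 2))) → (∃ U₀ : Subgroup (GL (Fin 2) (IsDedekindDomain.FiniteAdeleRing (NumberField.RingOfIntegers K) K)), IsOpen (U₀ : Set (GL (Fin 2) (IsDedekindDomain.FiniteAdeleRing (NumberField.RingOfIntegers K) K))) ∧ U₀ ≤ Literature.NumberTheory.Automorphic.glFiniteIntegralLevel 2 K ∧ (∀ g ∈ Literature.NumberTheory.Automorphic.glFiniteIntegralLevel 2 K, (∀ v : IsDedekindDomain.HeightOneSpectrum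 (NumberField.RingOfIntegers K), ¬ (∀ ℓ ∈ S₀, ((ℓ : ℕ) : NumberField.RingOfIntegers K) ∉ v.asIdeal) → ∀ i j : Fin 2, ((g : Matrix (Fin 2) (Fin 2) (IsDedekindDomain.FiniteAdeleRing (NumberField.RingOfIntegers K) K)) i j) v = (1 : Matrix (Fin 2) (Fin 2) (v.adicCompletion K)) i j) → g ∈ U₀) ∧ ∃ b : {v : IsDedekindDomain.HeightOneSpectrum (NumberField.RingOfIntegers K) // ∀ ℓ ∈ S₀, ((ℓ : ℕ) : NumberField.RingOfIntegers K) ∉ v.asIdeal} → ℕ → (Valued.v (R := PadicAlgCl 2)).valuationSubring, (∀ j : {v : IsDedekindDomain.HeightOneSpectrum (NumberField.RingOfIntegers K) // ∀ ℓ ∈ S₀, ((ℓ : ℕ) : NumberField.RingOfIntegers K) ∉ v.asIdeal} × Fin 2, ‖((b j.1 (j.2.val + 1) : (Valued.v (R := PadicAlgCl 2)).valuationSubring) : PadicAlgCl 2) - ((a j.1 (j.2.val + 1) : (Valued.v (R := PadicAlgCl 2)).valuationSubring) : PadicAlgCl 2)‖ < 1) ∧ Literature.NumberTheory.Automorphic.IsHeckePoint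 (Matrix.GeneralLinearGroup.map (n := Fin 2) (algebraMap K (IsDedekindDomain.FiniteAdeleRing (NumberField.RingOfIntegers K) K))) (Literature.NumberTheory.Automorphic.LevelTower.ofSeq U₀ (fun r : ℕ => (Literature.NumberTheory.Automorphic.principalCongruenceLevel 2 K (Ideal.span {((2 : ℕ) : NumberField.RingOfIntegers K)} ^ r)).map (Literature.NumberTheory.Automorphic.GLn.sndHom 2 K))) ((2 : ℕ) : (Valued.v (R := PadicAlgCl 2)).valuationSubring) (fun j : {v : IsDedekindDomain.HeightOneSpectrum (NumberField.RingOfIntegers K) // ∀ ℓ ∈ S₀, ((ℓ : ℕ) : NumberField.RingOfIntegers K) ∉ v.asIdeal} × Fin 2 => Literature.NumberTheory.Automorphic.GLn.sndHom 2 K (Literature.NumberTheory.Automorphic.heckeDiagAt 2 K j.1.1 (ϖ j.1.1) (j.2.val + 1))) (fun j => b j.1 (j.2.val + 1))) → ∃ U : Subgroup (GL (Fin 2) (IsDedekindDomain.FiniteAdeleRing (NumberField.RingOfIntegers K) K)), IsOpen (U : Set (GL (Fin 2) (IsDedekindDomain.FiniteAdeleRing (NumberField.RingOfIntegers K) K)))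 ∧ U ≤ Literature.NumberTheory.Automorphic.glFiniteIntegralLevel 2 K ∧ (∀ g ∈ Literature.NumberTheory.Automorphic.glFiniteIntegralLevel 2 K, (∀ v : IsDedekindDomain.HeightOneSpectrum (NumberField.RingOfIntegers K), ¬ (∀ ℓ ∈ S₀, ((ℓ : ℕ) : NumberField.RingOfIntegers K) ∉ v.asIdeal) → ∀ i j : Fin 2, ((g : Matrix (Fin 2) (Fin 2) (IsDedekindDomain.FiniteAdeleRing (NumberField.RingOfIntegers K) K)) i j) v = (1 : Matrix (Fin 2) (Fin 2) (v.adicCompletion K)) i j) → g ∈ U) ∧ Literature.NumberTheory.Automorphic.IsHeckePoint (Matrix.GeneralLinearGroup.map (n := Fin 2) (algebraMap K (IsDedekindDomain.FiniteAdeleRing (NumberField.RingOfIntegers K) K))) (Literature.NumberTheory.Automorphic.LevelTower.ofSeq U (fun r : ℕ => (Literature.NumberTheory.Automorphic.principalCongruenceLevel 2 K (Ideal.span {((2 : ℕ) : NumberField.RingOfIntegers K)} ^ r)).map (Literature.NumberTheory.Automorphic.GLn.sndHom 2 K))) ((2 : ℕ) : (Valued.v (R := PadicAlgCl 2)).valuationSubring)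 (fun j : {v : IsDedekindDomain.HeightOneSpectrum (NumberField.RingOfIntegers K) // ∀ ℓ ∈ S₀, ((ℓ : ℕ) : NumberField.RingOfIntegers K) ∉ v.asIdeal} × Fin 2 => Literature.NumberTheory.Automorphic.GLn.sndHom 2 K (Literature.NumberTheory.Automorphic.heckeDiagAt 2 K j.1.1 (ϖ j.1.1) (j.2.val + 1))) (fun j => a j.1 (j.2.val + 1))

open scoped NumberField MatrixGroups in
open IsDedekindDomain Literature.NumberTheory.GaloisRepresentations Literature.NumberTheory.Automorphic in
/-- **`ArtinLiftIsHeckePointTwo` is the registered stub `stub_artinLift` of `Lines/Sketch.lean`, verbatim**: the two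
spellings (fully-qualified Theses vocabulary above; the skeleton's `open`ed vocabulary below, copied from
`Lines/Sketch.lean` ll. 151–203) are definitionally equal (`Iff.rfl`).  Consequently, once a planner files the body of
`ArtinLiftIsHeckePointTwo` as a route decl `X_B`, the crux E2′ closes modulo the Literature named fact A by the LANDED
bridge: `TwoAdicBianchiProModularityLevel_of_artinLift ‹A› X_B_holds`
(`Theorems/ParityBlindBianchiTwoAdicBianchiProModularityLevelBridge.lean`, p108612; not imported here only because the
farm snapshot had not built that module when this workfile was written). [difficulty: open-problem] -/
theorem artinLiftIsHeckePointTwo_iff_stub :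
    ArtinLiftIsHeckePointTwo ↔ (∀ (K : Type) [Field K] [NumberField K], NumberField.IsTotallyComplex K →
    Module.finrank ℚ K = 2 →
    (∃ v w : HeightOneSpectrum (𝓞 K), v ≠ w ∧ ((2 : ℕ) : 𝓞 K) ∈ v.asIdeal ∧
      ((2 : ℕ) : 𝓞 K) ∈ w.asIdeal) →
    ∀ (σ : FramedGaloisRep K (PadicAlgCl 2) 2),
    Finite σ.toMonoidHom.range → σ.toGaloisRep.IsIrreducible →
    Nonempty ((Matrix.ProjGenLinGroup.mk.comp σ.toMonoidHom).range ≃* alternatingGroup (Fin 5)) →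
    ∀ S₀ : Finset ℕ, 2 ∈ S₀ →
    ∀ (ϖ : ∀ v : HeightOneSpectrum (𝓞 K), (v.adicCompletion K)ˣ),
    (∀ v : HeightOneSpectrum (𝓞 K),
      Valued.v ((ϖ v : (v.adicCompletion K)ˣ) : v.adicCompletion K) = WithZero.exp (-1 : ℤ)) →
    ∀ (a : {v : HeightOneSpectrum (𝓞 K) // ∀ ℓ ∈ S₀, ((ℓ : ℕ) : 𝓞 K) ∉ v.asIdeal} → ℕ →
      (PadicAlgCl.valued 2).v.valuationSubring),
    (∀ (v : HeightOneSpectrum (𝓞 K)) (hv : ∀ ℓ ∈ S₀, ((ℓ : ℕ) : 𝓞 K) ∉ v.asIdeal),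
      σ.IsHeckeAssociatedAt v (fun i : ℕ => if i = 0 then (1 : PadicAlgCl 2) else
        ((a ⟨v, hv⟩ i : (PadicAlgCl.valued 2).v.valuationSubring) : PadicAlgCl 2))) →
    (∃ U₀ : Subgroup (GL (Fin 2) (FiniteAdeleRing (𝓞 K) K)),
      IsOpen (U₀ : Set (GL (Fin 2) (FiniteAdeleRing (𝓞 K) K))) ∧
      U₀ ≤ glFiniteIntegralLevel 2 K ∧
      (∀ g ∈ glFiniteIntegralLevel 2 K,
        (∀ v : HeightOneSpectrum (𝓞 K), ¬ (∀ ℓ ∈ S₀, ((ℓ : ℕ) : 𝓞 K) ∉ v.asIdeal) →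
          ∀ i j : Fin 2, ((g : Matrix (Fin 2) (Fin 2) (FiniteAdeleRing (𝓞 K) K)) i j) v =
            (1 : Matrix (Fin 2) (Fin 2) (v.adicCompletion K)) i j) → g ∈ U₀) ∧
      ∃ b : {v : HeightOneSpectrum (𝓞 K) // ∀ ℓ ∈ S₀, ((ℓ : ℕ) : 𝓞 K) ∉ v.asIdeal} → ℕ →
          (PadicAlgCl.valued 2).v.valuationSubring,
        (∀ j : {v : HeightOneSpectrum (𝓞 K) // ∀ ℓ ∈ S₀, ((ℓ : ℕ) : 𝓞 K) ∉ v.asIdeal} × Fin 2,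
          ‖((b j.1 (j.2.val + 1) : (PadicAlgCl.valued 2).v.valuationSubring) : PadicAlgCl 2) -
            ((a j.1 (j.2.val + 1) : (PadicAlgCl.valued 2).v.valuationSubring) : PadicAlgCl 2)‖ < 1) ∧
        IsHeckePoint
          (Matrix.GeneralLinearGroup.map (algebraMap K (FiniteAdeleRing (𝓞 K) K)) :
            GL (Fin 2) K →* GL (Fin 2) (FiniteAdeleRing (𝓞 K) K))
          (LevelTower.ofSeq U₀ (fun r : ℕ =>
            (principalCongruenceLevel 2 K (Ideal.span {((2 : ℕ) : 𝓞 K)} ^ r)).map (GLn.sndHom 2 K)))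
          ((2 : ℕ) : (PadicAlgCl.valued 2).v.valuationSubring)
          (fun j : {v : HeightOneSpectrum (𝓞 K) // ∀ ℓ ∈ S₀, ((ℓ : ℕ) : 𝓞 K) ∉ v.asIdeal} × Fin 2 =>
            GLn.sndHom 2 K (heckeDiagAt 2 K j.1.1 (ϖ j.1.1) (j.2.val + 1)))
          (fun j => b j.1 (j.2.val + 1))) →
    ∃ U : Subgroup (GL (Fin 2) (FiniteAdeleRing (𝓞 K) K)),
      IsOpen (U : Set (GL (Fin 2) (FiniteAdeleRing (𝓞 K) K))) ∧
      U ≤ glFiniteIntegralLevel 2 K ∧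
      (∀ g ∈ glFiniteIntegralLevel 2 K,
        (∀ v : HeightOneSpectrum (𝓞 K), ¬ (∀ ℓ ∈ S₀, ((ℓ : ℕ) : 𝓞 K) ∉ v.asIdeal) →
          ∀ i j : Fin 2, ((g : Matrix (Fin 2) (Fin 2) (FiniteAdeleRing (𝓞 K) K)) i j) v =
            (1 : Matrix (Fin 2) (Fin 2) (v.adicCompletion K)) i j) → g ∈ U) ∧
      IsHeckePoint
        (Matrix.GeneralLinearGroup.map (algebraMap K (FiniteAdeleRing (𝓞 K) K)) :
          GL (Fin 2) K →* GL (Fin 2) (FiniteAdeleRing (𝓞 K) K))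
        (LevelTower.ofSeq U (fun r : ℕ =>
          (principalCongruenceLevel 2 K (Ideal.span {((2 : ℕ) : 𝓞 K)} ^ r)).map (GLn.sndHom 2 K)))
        ((2 : ℕ) : (PadicAlgCl.valued 2).v.valuationSubring)
        (fun j : {v : HeightOneSpectrum (𝓞 K) // ∀ ℓ ∈ S₀, ((ℓ : ℕ) : 𝓞 K) ∉ v.asIdeal} × Fin 2 =>
          GLn.sndHom 2 K (heckeDiagAt 2 K j.1.1 (ϖ j.1.1) (j.2.val + 1)))
        (fun j => a j.1 (j.2.val + 1))) :=
  Iff.rfl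

end Summit.Langlands.Langlands.Cruxes.TwoAdicBianchiProModularityLevel.PromoteB

end
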